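import Literature.NumberTheory.LFunctions.TraceWeightsOverPrimes
import Literature.NumberTheory.LFunctions.BilinearHyperKloostermanSumsPrimeModulus

/-!
# Hyper-Kloosterman sums `Kl_m` (every `m ≥ 2`) against primes and the Möbius function to ONE prime modulus:
# Fouvry–Kowalski–Michel 2014, Theorems 1.5 and 1.7 — the `Kl_m` INSTANCE (the companion
# `TraceWeightsOverPrimes.lean` typed `m = 2`; the `m ≥ 3` weights are now sayable over `klHyper`)

É. Fouvry, E. Kowalski, Ph. Michel, *Algebraic trace functions over the primes*, Duke Math. J. 163 (2014) 1683–1736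
[FouvryKowalskiMichel2014TracePrimes] (held text = arXiv:1211.6043; read on the chunk files of
`lit read paper:arxiv-1211.6043`: definition of `Kl_m` p0003:L70–80, exceptional weights p0004:L20–35, condition (1.6)
p0004:L37–45, **Theorem 1.5** p0004:L48–66, Remark 1.6 p0004:L68–90, **Theorem 1.7** p0004:L94–109, the sheaf `𝒦ℓ_m`
§5.2 p0016:L113–134, Remark 1.4 p0004:L1–2 «for the hyper-Kloosterman sums `K(n) = Kl_m(n;p)`, the conductor is
`m + 3`»).

WHY THE `Kl_m` INSTANCE IS AN INSTANCE (verbatim reasoning of the companion's module docstring, which already quotes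
§5.2 for general `m`): `𝒦ℓ_m` has rank `m`, is lisse on `𝔾_m`, geometrically irreducible (monodromy `SL_m`/`Sp_m`),
pointwise pure of weight `0`, conductor `m + 3`, with `ι(tr(Frob_a | 𝒦ℓ_m)) = (−1)^{m−1} Kl_m(a; p)` (p0016:L113–134);
so for every prime `p` and `a ∈ 𝔽_p^×` the weight `n ↦ Kl_m(a n; p)` (pull-back by `x ↦ a x`) is, up to the sign
`(−1)^{m−1}`, an isotypic trace weight of conductor `m + 3`, irreducible of rank `m ≥ 2`, hence NOT exceptional
(exceptional = sum of copies of a rank-one `𝓛_χ ⊗ 𝓛_ψ`, p0004:L31–35) — exactly the hypotheses of Theorems 1.5 and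
1.7, with conductor depending on `m` alone; the implied constants «depend only on `η`, `cond(𝓕)` [polynomially] and
the implicit constants in (1.6)», i.e. on `m`, `η` and the test-function budget. The statements below are therefore
the source's theorems AS PRINTED, specialised to this named family (nothing asserted, nothing proved).

## Why here (cell landau-siegel §D, card `z-degree-toeplitz-band`, crux K1″ why-fail (iii), face (W-r))

The wrap-around of the ψ-graded degree-2 table is a bilinear form `Σ_g Σ_r d₃(g)(μ∗χb)(r)·Kl₃(g·r·n̄; p)` (author's
F2-conversion note §3; `KnifeEdgeLenZDegreeConversion.familyGaussMoment_holds`). Its `(μ∗χb)`-face («W-r») carries the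
Möbius variable `a` of `1/L(s,ψ)` expanded exactly: the critic's C0 reading (ls-knife-crit-1 g2, 2026-08-27T02:33:19Z
(4)) names **FKM14 Theorem 1.7 (trace weights vs. Möbius)** — `Σ_n μ(n)K(n)V(n/X) ≪ QX(1 + p/X)^{1/6}p^{−η}`,
`η < 1/24`, non-trivial from `X ≈ p^{3/4}` [corpus:paper:arxiv-1211.6043 p4 L94–L126] — as the in-print POWER saving
for that variable against `Kl₃(g m₁ n̄·a; p)` once `a ≥ p^{3/4+ε}`. This file types that pointer for `K = Kl_m`, every
`m` (the card meets `m = 3`). «The programme SEARCHES and TYPES; no claim about Landau–Siegel zeros, Theorems 1–2 of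
arXiv:2211.02515 or a repaired Margin232 until a kernel theorem says so.»

## Contents
* `FKM2014.klHyperWeight m p a n = Kl_m(a·n; p)` (over `klHyper`, `BilinearHyperKloostermanSumsPrimeModulus.lean`);
  `klHyperWeight_two` (proved: at `m = 2` and `p ∤ n` it is the companion's `klWeight p a n`).
* `primeSumSmoothHyper`, `primeSumSharpHyper`, `moebiusSumSmoothHyper`, `moebiusSumSharpHyper` (the four sums of
  Theorems 1.5/1.7 with `K = Kl_m(a·;p)`; same finite truncations and test functions `FKM2014.TestFunction` as the
  companion).
* named facts `fouvryKowalskiMichel2014_theorem15_hyper`, `fouvryKowalskiMichel2014_theorem17_hyper` (every `m ≥ 2`).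
Deliberately NOT here: Theorems 1.15/1.16 for `Kl_m` (no consumer), Corollary 1.13's explicit constants, [HNY] sums.
`-- TODO(general form): isotypic non-exceptional trace weights of bounded conductor (needs ℓ-adic-sheaf vocabulary).`

## References
* É. Fouvry, E. Kowalski, Ph. Michel, Duke Math. J. 163 (2014), no. 9, 1683–1736; arXiv:1211.6043. Thm 1.5, Rem 1.6,
  Thm 1.7, Rem 1.4, §5.2. [cite: FouvryKowalskiMichel2014TracePrimes, Thm 1.5, Thm 1.7, Rem 1.4, §5.2]
-/

noncomputable section

open scoped Classical
open Finset

namespace Literature.NumberTheory.LFunctions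

namespace FKM2014

/-! ### The weight `K(n) = Kl_m(a·n; p)` and the four sums -/

/-- The hyper-Kloosterman trace weight on the integers, `K(n) = Kl_m(a·n; p)` (`a ∈ 𝔽_p^×` fixed; evaluated by the
defining formula `p^{−(m−1)/2} Σ_{x₁⋯x_m = a n} e((x₁+⋯+x_m)/p)` at every residue, in particular at `n ≡ 0`, where
the all-tuples sum equals `(−1)^{m+1}` — immaterial to the facts, as in the companion's «Value at `n ≡ 0`»).
[cite: FouvryKowalskiMichel2014TracePrimes, §1 (definition of `Kl_m`) p0003:L70–80, Rem 1.4] -/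
def klHyperWeight (m p : ℕ) [NeZero p] (a : ZMod p) (n : ℕ) : ℂ := klHyper m p (a * (n : ZMod p))

/-- Unfolding of `klHyperWeight`. [cite: FouvryKowalskiMichel2014TracePrimes, §1 (definition of `Kl_m`)] -/
theorem klHyperWeight_def (m p : ℕ) [NeZero p] (a : ZMod p) (n : ℕ) :
    klHyperWeight m p a n = klHyper m p (a * (n : ZMod p)) := rfl

/-- **Rank 2 is the companion's weight (proved):** for a unit argument `a·n` (e.g. `a ∈ 𝔽_p^×`, `p ∤ n`),
`klHyperWeight 2 p a n = klWeight p a n` (`klHyper_two_eq_kl₂`; `FKM2014.kl2` and `kl₂` are the same formula).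
[cite: FouvryKowalskiMichel2014TracePrimes, §1 (definition of `Kl_m`), m = 2] -/
theorem klHyperWeight_two (p : ℕ) [NeZero p] {a : ZMod p} {n : ℕ} (h : IsUnit (a * (n : ZMod p))) :
    klHyperWeight 2 p a n = klWeight p a n := by
  rw [klHyperWeight_def, klWeight_def, klHyper_two_eq_kl₂ p h, kl₂_def]

/-- The smoothed prime sum `Σ_{q prime} K(q) V(q/X)` with `K = Kl_m(a·; p)` (finite: `q ≤ ⌊2X⌋` by the support
of `V`). [cite: FouvryKowalskiMichel2014TracePrimes, Thm 1.5] -/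
def primeSumSmoothHyper (m p : ℕ) [NeZero p] (a : ZMod p) (V : ℝ → ℝ) (X : ℝ) : ℂ :=
  ∑ q ∈ (Finset.Icc 1 ⌊2 * X⌋₊).filter Nat.Prime, klHyperWeight m p a q * ((V ((q : ℝ) / X) : ℝ) : ℂ)

/-- The sharp prime sum `Σ_{q prime, q ≤ X} K(q)` with `K = Kl_m(a·; p)`. [cite: FouvryKowalskiMichel2014TracePrimes, Thm 1.5] -/
def primeSumSharpHyper (m p : ℕ) [NeZero p] (a : ZMod p) (X : ℝ) : ℂ :=
  ∑ q ∈ (Finset.Icc 1 ⌊X⌋₊).filter Nat.Prime, klHyperWeight m p a q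

/-- The smoothed Möbius sum `Σ_n μ(n) K(n) V(n/X)` with `K = Kl_m(a·; p)` (finite: `n ≤ ⌊2X⌋`).
[cite: FouvryKowalskiMichel2014TracePrimes, Thm 1.7] -/
def moebiusSumSmoothHyper (m p : ℕ) [NeZero p] (a : ZMod p) (V : ℝ → ℝ) (X : ℝ) : ℂ :=
  ∑ n ∈ Finset.Icc 1 ⌊2 * X⌋₊,
    ((ArithmeticFunction.moebius n : ℤ) : ℂ) * klHyperWeight m p a n * ((V ((n : ℝ) / X) : ℝ) : ℂ)

/-- The sharp Möbius sum `Σ_{n ≤ X} μ(n) K(n)` with `K = Kl_m(a·; p)`. [cite: FouvryKowalskiMichel2014TracePrimes, Thm 1.7] -/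
def moebiusSumSharpHyper (m p : ℕ) [NeZero p] (a : ZMod p) (X : ℝ) : ℂ :=
  ∑ n ∈ Finset.Icc 1 ⌊X⌋₊, ((ArithmeticFunction.moebius n : ℤ) : ℂ) * klHyperWeight m p a n

/-! ### Fouvry–Kowalski–Michel 2014, Theorems 1.5 and 1.7 for `K = Kl_m(a·;p)`, every `m ≥ 2` (named facts) -/

/-- **Fouvry–Kowalski–Michel 2014, Theorem 1.5 (trace weights vs. primes) — hyper-Kloosterman instance, every
`m ≥ 2`.** As printed (p0004:L48–66): «Let `K` be an isotypic trace weight on `𝔽_p` associated to some sheaf `𝓕`, and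
assume that `𝓕` is not exceptional. Let `V` be a smooth function as above satisfying (1.6) for some parameter
`Q ≥ 1`. For any `X ≥ 2`, we have `Σ_{q prime} K(q)V(q/X) ≪ QX(1+p/X)^{1/6}p^{−η}`,
`Σ_{q prime, q ≤ X} K(q) ≪ X(1+p/X)^{1/12}p^{−η/2}`, for any `η < 1/24`. The implicit constants depend only on `η`,
`cond(𝓕)` and the implicit constants in (1.6). Moreover, the dependency on `cond(𝓕)` is at most polynomial.» For
`K(n) = Kl_m(a n; p)` (`cond = m + 3`): for every `m ≥ 2`, `η < 1/24` and budget `C` a constant `K₀` uniform in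
`p`, `a ≠ 0`, `Q`, `V`, `X`. Non-trivial from `X ≥ p^{3/4+ε}` (Remark 1.6). Status: theorem-in-print.
[cite: FouvryKowalskiMichel2014TracePrimes, Thm 1.5 p0004:L48–66] -/
def fouvryKowalskiMichel2014_theorem15_hyper : Prop :=
  ∀ m : ℕ, 2 ≤ m → ∀ η : ℝ, η < 1 / 24 → ∀ C : ℕ → ℝ, ∃ K₀ : ℝ, 0 < K₀ ∧
    ∀ (p : ℕ) [NeZero p], p.Prime → ∀ a : ZMod p, a ≠ 0 →
      (∀ (Q : ℝ), 1 ≤ Q → ∀ V : ℝ → ℝ, TestFunction C Q V → ∀ X : ℝ, 2 ≤ X →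
          ‖primeSumSmoothHyper m p a V X‖ ≤
            K₀ * Q * X * (1 + (p : ℝ) / X) ^ ((1 : ℝ) / 6) * (p : ℝ) ^ (-η)) ∧
      (∀ X : ℝ, 2 ≤ X →
          ‖primeSumSharpHyper m p a X‖ ≤ K₀ * X * (1 + (p : ℝ) / X) ^ ((1 : ℝ) / 12) * (p : ℝ) ^ (-η / 2))

/-- **Fouvry–Kowalski–Michel 2014, Theorem 1.7 (trace weights vs. Möbius) — hyper-Kloosterman instance, every
`m ≥ 2`.** As printed (p0004:L94–109): «Let `μ` denote the Möbius function. With the same notations and hypotheses as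
in Theorem 1.5, we have for `X ≥ 2` `Σ_n μ(n)K(n)V(n/X) ≪ QX(1+p/X)^{1/6}p^{−η}`, `Σ_{n ≤ X} μ(n)K(n) ≪
X(1+p/X)^{1/12}p^{−η/2}`, for any `η < 1/24`, where the implicit constants depend only on `η`, `cond(𝓕)` and the
implicit constants in (1.6), and the dependency on `cond(𝓕)` is at most polynomial.» For `K(n) = Kl_m(a n; p)`,
every `m ≥ 2`. Cell landau-siegel §D use: the in-print POWER saving for the Möbius face (W-r) of the `Kl₃` wrap-around
once its variable has length `≥ p^{3/4+ε}` (critic's C0 reading (4)). Status: theorem-in-print.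
[cite: FouvryKowalskiMichel2014TracePrimes, Thm 1.7 p0004:L94–109] -/
def fouvryKowalskiMichel2014_theorem17_hyper : Prop :=
  ∀ m : ℕ, 2 ≤ m → ∀ η : ℝ, η < 1 / 24 → ∀ C : ℕ → ℝ, ∃ K₀ : ℝ, 0 < K₀ ∧
    ∀ (p : ℕ) [NeZero p], p.Prime → ∀ a : ZMod p, a ≠ 0 →
      (∀ (Q : ℝ), 1 ≤ Q → ∀ V : ℝ → ℝ, TestFunction C Q V → ∀ X : ℝ, 2 ≤ X →
          ‖moebiusSumSmoothHyper m p a V X‖ ≤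
            K₀ * Q * X * (1 + (p : ℝ) / X) ^ ((1 : ℝ) / 6) * (p : ℝ) ^ (-η)) ∧
      (∀ X : ℝ, 2 ≤ X →
          ‖moebiusSumSharpHyper m p a X‖ ≤ K₀ * X * (1 + (p : ℝ) / X) ^ ((1 : ℝ) / 12) * (p : ℝ) ^ (-η / 2))

/-! ### Bookkeeping (proved) -/

/-- Remark 1.6 at `X = p` for `Kl_m`: Theorem 1.5's sharp bound reads `K₀ · p · 2^{1/12} · p^{−η/2}`.
[cite: FouvryKowalskiMichel2014TracePrimes, Rem. 1.6 p0004:L68–72] -/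
theorem fouvryKowalskiMichel2014_theorem15_hyper.at_conductor (h : fouvryKowalskiMichel2014_theorem15_hyper)
    {m : ℕ} (hm : 2 ≤ m) {η : ℝ} (hη : η < 1 / 24) (C : ℕ → ℝ) :
    ∃ K₀ : ℝ, 0 < K₀ ∧ ∀ (p : ℕ) [NeZero p], p.Prime → 2 ≤ (p : ℝ) → ∀ a : ZMod p, a ≠ 0 →
      ‖primeSumSharpHyper m p a p‖ ≤
        K₀ * (p : ℝ) * (1 + (p : ℝ) / (p : ℝ)) ^ ((1 : ℝ) / 12) * (p : ℝ) ^ (-η / 2) := by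
  obtain ⟨K₀, hK₀, hall⟩ := h m hm η hη C
  refine ⟨K₀, hK₀, fun p _ hp hp2 a ha => ?_⟩
  exact (hall p hp a ha).2 (p : ℝ) hp2

/-! ### Part 2 — consistency at `m = 2` (proved): at a prime the hyper weight IS the companion's weight at every `n`
(`klHyper_two_eq_kl₂_prime`, Bilinear… Part 4), so the every-`m` facts imply the companion's `m = 2` facts verbatim -/

/-- At a prime, `klHyperWeight 2 p a n = klWeight p a n` for every `n` (also `p ∣ n`: both weights are `−p^{−1/2}` there).
[cite: FouvryKowalskiMichel2014TracePrimes, §1 (definition of `Kl_m`), m = 2] -/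
theorem klHyperWeight_two_prime {p : ℕ} [Fact p.Prime] (a : ZMod p) (n : ℕ) :
    klHyperWeight 2 p a n = klWeight p a n := by
  rw [klHyperWeight_def, klWeight_def, klHyper_two_eq_kl₂_prime, kl₂_def]

/-- The four sums agree at `m = 2` (prime modulus). [cite: FouvryKowalskiMichel2014TracePrimes, Thm 1.5, Thm 1.7] -/
theorem sums_two_prime {p : ℕ} [Fact p.Prime] (a : ZMod p) (V : ℝ → ℝ) (X : ℝ) :
    primeSumSmoothHyper 2 p a V X = primeSumSmooth p a V X ∧ primeSumSharpHyper 2 p a X = primeSumSharp p a X ∧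
      moebiusSumSmoothHyper 2 p a V X = moebiusSumSmooth p a V X ∧ moebiusSumSharpHyper 2 p a X = moebiusSumSharp p a X := by
  refine ⟨?_, ?_, ?_, ?_⟩
  · exact Finset.sum_congr rfl fun q _ => by rw [klHyperWeight_two_prime]
  · exact Finset.sum_congr rfl fun q _ => by rw [klHyperWeight_two_prime]
  · exact Finset.sum_congr rfl fun n _ => by rw [klHyperWeight_two_prime]
  · exact Finset.sum_congr rfl fun n _ => by rw [klHyperWeight_two_prime]

/-- **The every-`m` typing of Theorem 1.5 implies the companion's Kloosterman instance (proved).**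
[cite: FouvryKowalskiMichel2014TracePrimes, Thm 1.5 p0004:L48–66] -/
theorem fouvryKowalskiMichel2014_theorem15_of_hyper (h : fouvryKowalskiMichel2014_theorem15_hyper) :
    fouvryKowalskiMichel2014_theorem15 := by
  intro η hη C
  obtain ⟨K₀, hK₀, hall⟩ := h 2 le_rfl η hη C
  refine ⟨K₀, hK₀, fun p _ hp a ha => ?_⟩
  haveI : Fact p.Prime := ⟨hp⟩
  obtain ⟨hs, hsh⟩ := hall p hp a ha
  refine ⟨fun Q hQ V hV X hX => ?_, fun X hX => ?_⟩
  · rw [← (sums_two_prime a V X).1]; exact hs Q hQ V hV X hX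
  · rw [← (sums_two_prime a (fun _ => 0) X).2.1]; exact hsh X hX

/-- **The every-`m` typing of Theorem 1.7 implies the companion's Kloosterman instance (proved).**
[cite: FouvryKowalskiMichel2014TracePrimes, Thm 1.7 p0004:L94–109] -/
theorem fouvryKowalskiMichel2014_theorem17_of_hyper (h : fouvryKowalskiMichel2014_theorem17_hyper) :
    fouvryKowalskiMichel2014_theorem17 := by
  intro η hη C
  obtain ⟨K₀, hK₀, hall⟩ := h 2 le_rfl η hη C
  refine ⟨K₀, hK₀, fun p _ hp a ha => ?_⟩
  haveI : Fact p.Prime := ⟨hp⟩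
  obtain ⟨hs, hsh⟩ := hall p hp a ha
  refine ⟨fun Q hQ V hV X hX => ?_, fun X hX => ?_⟩
  · rw [← (sums_two_prime a V X).2.2.1]; exact hs Q hQ V hV X hX
  · rw [← (sums_two_prime a (fun _ => 0) X).2.2.2]; exact hsh X hX

/-! ### Part 3 — «Value at `n ≡ 0 (mod p)`» made a theorem: for every rank `m ≥ 1` and every non-trivial additive character
`ψ` of the prime field, `Σ_{x₁⋯x_m = 0} ψ(x₁+⋯+x_m) = −(−1)^m` (all tuples sum to `0`, the all-unit tuples to `(−1)^m`, and a
tuple has product `0` iff some coordinate is `0`); so `K(n) = klHyper m p 0 = −(−1)^m·p^{−(m−1)/2}` on the `≤ ⌊2X/p⌋ + 1` multiples of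
`p` — the companion docstring's «at `n = 0` the sum is `−(−1)^m`», proved -/

open Literature.NumberTheory.GaussSums in
/-- **`Σ_{x₁⋯x_m = 0} ψ(x₁+⋯+x_m) = −(−1)^m` over a prime field, `m ≥ 1`, `ψ ≠ 1` (proved):** the sum over ALL tuples is
`(Σ_y ψ(y))^m = 0`; the tuples with non-zero product are exactly the all-unit (all-non-zero) tuples, summing to `(Σ_{y ≠ 0} ψ(y))^m
= (−1)^m`; subtract. [cite: FouvryKowalskiMichel2014TracePrimes, §1 (definition of `Kl_m`) p0003:L70–80] -/
theorem hyperKloosterman_zero_prime {p : ℕ} [Fact p.Prime] {ψ : AddChar (ZMod p) ℂ} (hψ : ψ ≠ 1) {m : ℕ} (hm : 1 ≤ m) :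
    hyperKloosterman m ψ (0 : ZMod p) = -((-1 : ℂ) ^ m) := by
  classical
  unfold hyperKloosterman
  -- ψ turns the coordinate sum into a product
  have hmul : ∀ x : Fin m → ZMod p, ψ (∑ i, x i) = ∏ i, ψ (x i) := fun x => addChar_map_sum ψ _ _
  simp_rw [hmul]
  -- all tuples: (Σ_y ψ y)^m = 0
  have hall : ∑ x : Fin m → ZMod p, ∏ i, ψ (x i) = 0 := by
    rw [← Fintype.piFinset_univ, ← Finset.prod_univ_sum (fun _ : Fin m => (Finset.univ : Finset (ZMod p)))
      (fun _ y => ψ y), AddChar.sum_eq_zero_of_ne_one hψ, Finset.prod_const, Finset.card_univ, Fintype.card_fin]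
    exact zero_pow (by omega)
  -- non-zero product ⟺ all coordinates non-zero; those tuples sum to (Σ_{y ≠ 0} ψ y)^m = (−1)^m
  have hunit : ∑ x ∈ (Finset.univ : Finset (Fin m → ZMod p)).filter (fun x => ¬ ∏ i, x i = 0), ∏ i, ψ (x i) =
      (-1 : ℂ) ^ m := by
    have hset : (Finset.univ : Finset (Fin m → ZMod p)).filter (fun x => ¬ ∏ i, x i = 0) =
        Fintype.piFinset (fun _ : Fin m => (Finset.univ : Finset (ZMod p)).filter (fun y => y ≠ 0)) := by
      ext x
      simp only [Finset.mem_filter, Finset.mem_univ, true_and, Fintype.mem_piFinset]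
      show (∏ i, x i ≠ 0) ↔ _
      rw [Finset.prod_ne_zero_iff]
      simp
    have hneg : ∑ y ∈ (Finset.univ : Finset (ZMod p)).filter (fun y => y ≠ 0), ψ y = -1 := by
      have h := Finset.sum_filter_add_sum_filter_not (Finset.univ : Finset (ZMod p)) (fun y => y ≠ 0) (fun y => ψ y)
      rw [AddChar.sum_eq_zero_of_ne_one hψ] at h
      have h0 : ∑ y ∈ (Finset.univ : Finset (ZMod p)).filter (fun y => ¬ y ≠ 0), ψ y = 1 := by
        rw [show (Finset.univ : Finset (ZMod p)).filter (fun y => ¬ y ≠ 0) = {0} by ext y; simp]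
        simp [AddChar.map_zero_eq_one]
      rw [h0] at h
      linear_combination h
    rw [hset, ← Finset.prod_univ_sum (fun _ : Fin m => (Finset.univ : Finset (ZMod p)).filter (fun y => y ≠ 0))
      (fun _ y => ψ y), hneg, Finset.prod_const, Finset.card_univ, Fintype.card_fin]
  have hsplit := Finset.sum_filter_add_sum_filter_not (Finset.univ : Finset (Fin m → ZMod p))
    (fun x => ∏ i, x i = 0) (fun x => ∏ i, ψ (x i))
  rw [hall, hunit] at hsplit
  linear_combination hsplit

/-- **The hyper weight on multiples of `p` (proved):** `klHyperWeight m p a n = −(−1)^m / p^{(m−1)/2}` whenever `p ∣ n`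
(`m ≥ 1`) — the finitely many exceptional terms the companion's «Value at `n ≡ 0`» paragraph accounts for.
[cite: FouvryKowalskiMichel2014TracePrimes, §1 (definition of `Kl_m`), Rem 1.4] -/
theorem klHyperWeight_of_dvd {m p : ℕ} [Fact p.Prime] (hm : 1 ≤ m) (a : ZMod p) {n : ℕ} (hn : p ∣ n) :
    klHyperWeight m p a n = -((-1 : ℂ) ^ m) / (((p : ℝ) ^ (((m : ℝ) - 1) / 2) : ℝ) : ℂ) := by
  rw [klHyperWeight_def, (ZMod.natCast_eq_zero_iff n p).mpr hn, mul_zero, klHyper_def,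
    hyperKloosterman_zero_prime Literature.NumberTheory.GaussSums.stdAddChar_ne_one hm]

end FKM2014

/-! ### Part 4 — Fouvry–Kowalski–Michel 2014, Theorem 1.17 (type II / type I ABOVE the Pólya–Vinogradov range) for the
hyper-Kloosterman weight `K(n) = Kl_m(a n; p)`, EVERY `m ≥ 2` (the companion typed `m = 2`; Kl_m = `[×a]*𝒦ℓ_m`, rank `m`,
geometrically irreducible hence isotypic and non-exceptional, conductor `m + 3` — FKM14 §5.2 p0016:L113–134 / Rem 1.4, as in
this file's module docstring; the printed constants depend polynomially on the conductor, hence on `m` alone here).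
Cell landau-siegel §D use: the route `ZDegreeToeplitzBand`'s «Pólya–Vinogradov-range completion covers `N ≥ p^{1/2+ε}`» for
the `Kl₃` wrap-around, by decl name (KMS is needed only below `p^{1/2}`). -/

/-- **Fouvry–Kowalski–Michel 2014, Theorem 1.17 (1) — type II sums — hyper-Kloosterman instance, every `m ≥ 2`.** As printed
(arXiv:1211.6043 §1.5, p0008:L6–27): «Let `K` be a non-exceptional trace weight modulo `p` associated to an isotypic `ℓ`-adic
sheaf `𝓕`. Let `M, N ≥ 1` be parameters, and let `(α_m)_m`, `(β_n)_n` be sequences supported on `[M/2, 2M]` and `[N/2, 2N]`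
respectively. (1) We have `ΣΣ_{m,n,(m,p)=1} α_m β_n K(mn) ≪ ‖α‖‖β‖(MN)^{1/2}(p^{-1/4} + M^{-1/2} + p^{1/4}log^{1/2}p·N^{-1/2})`
… the implicit constants depend only, and at most polynomially, on the conductor of `𝓕`.» For `K(n) = Kl_m(a n; p)`, `a ≠ 0`:
one constant per `m`. Binders as the companion's `m = 2` typing. Non-trivial once `N ≫ p^{1/2} log p` and `M ≫ 1`.
Status: theorem-in-print. [cite: FouvryKowalskiMichel2014TracePrimes, Theorem 1.17 (1)] -/
def fouvryKowalskiMichel2014_theorem117_typeII_hyper : Prop :=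
  ∀ k : ℕ, 2 ≤ k → ∃ C : ℝ, 0 < C ∧
    ∀ (p : ℕ) [Fact p.Prime] (a : ZMod p), a ≠ 0 →
    ∀ (M N : ℝ), 1 ≤ M → 1 ≤ N →
    ∀ (α β : ℕ → ℂ),
      (∀ m : ℕ, α m ≠ 0 → M / 2 ≤ (m : ℝ) ∧ (m : ℝ) ≤ 2 * M) →
      (∀ n : ℕ, β n ≠ 0 → N / 2 ≤ (n : ℝ) ∧ (n : ℝ) ≤ 2 * N) →
      ‖∑ m ∈ Icc 1 ⌊2 * M⌋₊, ∑ n ∈ Icc 1 ⌊2 * N⌋₊,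
          (if m.Coprime p then α m * β n * klHyper k p (a * (m : ZMod p) * (n : ZMod p)) else 0)‖ ≤
        C * Real.sqrt (∑ m ∈ Icc 1 ⌊2 * M⌋₊, ‖α m‖ ^ 2) *
          Real.sqrt (∑ n ∈ Icc 1 ⌊2 * N⌋₊, ‖β n‖ ^ 2) * (M * N) ^ (1 / 2 : ℝ) *
          ((p : ℝ) ^ (-(1 / 4 : ℝ)) + M ^ (-(1 / 2 : ℝ)) +
            (p : ℝ) ^ (1 / 4 : ℝ) * (Real.log p) ^ (1 / 2 : ℝ) * N ^ (-(1 / 2 : ℝ)))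

/-- **Fouvry–Kowalski–Michel 2014, Theorem 1.17 (2) — type I sums — hyper-Kloosterman instance, every `m ≥ 2`.** As printed
(p0008:L28–35): «(2) We have `Σ_{(m,p)=1} α_m Σ_{n ≤ N} K(mn) ≪ (Σ_m |α_m|) N (p^{-1/2} + p^{1/2} log p / N)`.» For
`K(n) = Kl_m(a n; p)`, `a ≠ 0`, one constant per `m`; non-trivial once `N ≫ p^{1/2} log p`. Status: theorem-in-print.
[cite: FouvryKowalskiMichel2014TracePrimes, Theorem 1.17 (2)] -/
def fouvryKowalskiMichel2014_theorem117_typeI_hyper : Prop :=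
  ∀ k : ℕ, 2 ≤ k → ∃ C : ℝ, 0 < C ∧
    ∀ (p : ℕ) [Fact p.Prime] (a : ZMod p), a ≠ 0 →
    ∀ (M N : ℝ), 1 ≤ M → 1 ≤ N →
    ∀ (α : ℕ → ℂ),
      (∀ m : ℕ, α m ≠ 0 → M / 2 ≤ (m : ℝ) ∧ (m : ℝ) ≤ 2 * M) →
      ‖∑ m ∈ Icc 1 ⌊2 * M⌋₊,
          (if m.Coprime p then α m * ∑ n ∈ Icc 1 ⌊N⌋₊, klHyper k p (a * (m : ZMod p) * (n : ZMod p))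
            else 0)‖ ≤
        C * (∑ m ∈ Icc 1 ⌊2 * M⌋₊, ‖α m‖) * N *
          ((p : ℝ) ^ (-(1 / 2 : ℝ)) + (p : ℝ) ^ (1 / 2 : ℝ) * Real.log p / N)

/-- **The every-`m` typing of Theorem 1.17 (1) implies the companion's `m = 2` typing (proved; `klHyper_two_eq_kl₂_prime`).**
[cite: FouvryKowalskiMichel2014TracePrimes, Theorem 1.17 (1)] -/
theorem fouvryKowalskiMichel2014_theorem117_typeII_of_hyper (h : fouvryKowalskiMichel2014_theorem117_typeII_hyper) :
    fouvryKowalskiMichel2014_theorem117_typeII := by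
  obtain ⟨C, hC, hb⟩ := h 2 le_rfl
  refine ⟨C, hC, fun p _ a ha M N hM hN α β hα hβ => ?_⟩
  have := hb p a ha M N hM hN α β hα hβ
  simp only [klHyper_two_eq_kl₂_prime] at this
  exact this

/-- **… and of Theorem 1.17 (2).** [cite: FouvryKowalskiMichel2014TracePrimes, Theorem 1.17 (2)] -/
theorem fouvryKowalskiMichel2014_theorem117_typeI_of_hyper (h : fouvryKowalskiMichel2014_theorem117_typeI_hyper) :
    fouvryKowalskiMichel2014_theorem117_typeI := by
  obtain ⟨C, hC, hb⟩ := h 2 le_rfl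
  refine ⟨C, hC, fun p _ a ha M N hM hN α hα => ?_⟩
  have := hb p a ha M N hM hN α hα
  simp only [klHyper_two_eq_kl₂_prime] at this
  exact this

end Literature.NumberTheory.LFunctions

end
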